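import Literature.Analysis.FluidPDE.TorusClassicalNSH2Smoothing
import Literature.Analysis.FunctionSpaces.TorusConvectionLaplacianNormSq
import HarnessLib

/-!
# The `H²` balance of the linearised Navier–Stokes equation along a smooth field on the torus,
# and its flux bound on `T³`

Analysis/FluidPDE proof file (theorems only; no definitions, no named facts), the `H²` sequel of
`TorusLinearisedNSH1Balance.lean` (the `H¹` balance of the first variation equation) and the LINEAR
twin of `TorusClassicalNSH2Smoothing.lean` (the `H²` balance and flux bound of the nonlinear
system). For a jointly smooth solution `(w, q)` of the linearised Navier–Stokes equation
`∂ₜw + (u·∇)w + (w·∇)u = νΔw − ∇q`, `div w = 0`, along a jointly smooth field `u` on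
`[a, b] × T^d` (Constantin–Foias 1988, Ch. 14, (14.3); clauses as separate hypotheses, no
predicate):

* `Torus.linearisedNS_hasDerivWithinAt_half_integral_norm_laplacian_sq` — the `H²` BALANCE
  `d/dt ½‖Δw‖₂² = −ν‖∇Δw‖₂² − ∫ ⟪(u·∇)w + (w·∇)u, ΔΔw⟫` within `[a, b]` (pair the equation with
  `ΔΔw`: `∂ₜΔ = Δ∂ₜ`, Green's second identity, `∫ ⟪ΔΔw, Δw⟫ = −‖∇Δw‖₂²`, and the pressure drops
  out because `ΔΔw` is divergence free; neither incompressibility of `u` nor a mean condition is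
  needed) — "the inner product of the equation with `A²U`" (Foias–Manley–Rosa–Temam 2001,
  App. II.A (A.55) and Ch. II §7, for the nonlinear system);
* `Torus.linearisedNS_laplacian_flux_le` — the FLUX BOUND on `T³` for zero-mean `w`, with
  `F = (u·∇)w + (w·∇)u`, `‖u‖ ≤ M`, `‖∂ₖu‖ ≤ L`:
  `−ν‖∇Δw‖₂² − ∫ ⟪F, ΔΔw⟫ ≤ ν⁻¹ (2dM² ‖Δw‖₂² + 4d²L² ‖∇w‖₂² + 2dK (‖∇w‖₂² + ‖Δw‖₂²) ‖Δu‖₂²)`: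
  Young `|∫ ⟪F, ΔΔw⟫| ≤ (2ν)⁻¹‖∇F‖₂² + (ν/2)‖∇Δw‖₂²`, `‖∇F‖₂² ≤ 2‖∇((u·∇)w)‖₂² + 2‖∇((w·∇)u)‖₂²`,
  the transport shape `‖∇((u·∇)w)‖₂² ≤ 2dM²‖Δw‖₂² + 2d²L²‖∇w‖₂²`, the stretching shape
  `‖∇((w·∇)u)‖₂² ≤ 2d‖w‖²_∞‖Δu‖₂² + 2d²L²‖∇w‖₂²`, and the sup-norm embedding
  `‖w‖²_∞ ≤ K(‖∇w‖₂² + ‖Δw‖₂²)` of zero-mean fields on `T³` — the linearised form of the `k = 2`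
  differential inequality (7.3) of Robinson–Rodrigo–Sadowski 2016 ("`B` maps `D(A) × D(A)`
  boundedly into `V`", Constantin–Foias 1988, Ch. 6).

Consumed by the `V → D(A)` smoothing estimate of the linearised flow
(`TorusLinearisedNSH2Smoothing.lean`). Deliberately NOT here: forces, backward estimates, the
`H³` level.

## Mathlib / tree search

Tree (reused): `Torus.abs_integral_inner_laplacian_le_gradNormSq` (`TorusClassicalNSH2Smoothing`),
`Torus.integral_inner_laplacian_self_eq_neg_gradNormSq` (`TorusClassicalHnBalance`),
`Torus.IsDivFree.laplacian_of_isSmooth`, `Torus.integral_inner_gradient_eq_zero_of_isDivFree`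
(`TorusClassicalH1Balance` and its imports), `Torus.gradNormSq_convect_le_of_norm_left_le`,
`Torus.gradNormSq_convect_le_of_norm_right_le`, `Torus.gradNormSq_add_le`
(`TorusConvectionLaplacianNormSq`), `Torus.norm_sq_le_gradNormSq_add_of_hasZeroMean`
(`TorusConvectionGradNormSq`), `Torus.timeDerivWithin_laplacian_comm`
(`TorusInverseLaplacianCalculus`), `Torus.integral_inner_laplacian_comm`,
`Torus.IsSmoothSpaceTimeOn.hasDerivWithinAt_integral`, `….hasDerivWithinAt_slice`; the patterns are
`Torus.IsClassicalNSSolutionOn.hasDerivWithinAt_half_integral_norm_sq_laplacian_iterate` and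
`Torus.linearisedNS_hasDerivWithinAt_half_gradNormSq`. Searched `linearisedNS.*laplacian`,
`LinearisedNSH2`: nothing (the module docstring of `TorusLinearisedNSH1Balance` stops at `H¹`).

## References

* C. Foias, O. Manley, R. Rosa, R. Temam, *Navier–Stokes Equations and Turbulence*, CUP 2001,
  Ch. II App. A (A.55) and §7. [FoiasManleyRosaTemam2001]
* P. Constantin, C. Foias, *Navier–Stokes Equations*, Univ. Chicago Press 1988, Ch. 6, Ch. 14
  (14.2)–(14.4). [ConstantinFoiasNSE1988]
* J. C. Robinson, J. L. Rodrigo, W. Sadowski, *The Three-Dimensional Navier–Stokes Equations*,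
  CUP 2016, Thm 7.1 (7.3). [RobinsonRodrigoSadowskiCUP2016]
-/

noncomputable section

open MeasureTheory Set Function Filter
open scoped ContDiff InnerProductSpace RealInnerProductSpace Topology

namespace Literature.Analysis.FluidPDE

open Literature.Analysis.FunctionSpaces

variable {d : Type*} [Fintype d] [DecidableEq d]

/-! ### The `H²` balance of the linearised equation -/

/-- **The `H²` balance of the linearised Navier–Stokes equation on the torus.** Let `u` be
jointly smooth on `[a, b] × T^d` (`a < b`) and let `(w, q)` be jointly smooth with `div w(t) = 0`
and `∂ₜw + (u·∇)w + (w·∇)u = νΔw − ∇q` pointwise on `[a, b] × T^d` (one-sided time derivative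
within `[a, b]`). Then for every `t ∈ [a, b]`,
`d/dt ½ ∫ ‖Δw(t)‖² = −ν ‖∇Δw(t)‖₂² − ∫ ⟪(u·∇)w(t) + (w·∇)u(t), ΔΔw(t)⟫`
as a one-sided derivative within `[a, b]` — "the inner product of the first variation equation
with `A²U`" (the computation of Foias–Manley–Rosa–Temam 2001, App. II.A (A.55) / §7, for the
linearised system (14.3) of Constantin–Foias 1988): differentiate `½ ∫ ‖Δw‖²` under the integral,
`∂ₜ‖Δw‖² = 2⟪Δ∂ₜw, Δw⟫` with `∂ₜΔ = Δ∂ₜ` (`Torus.timeDerivWithin_laplacian_comm`), Green's second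
identity (`Torus.integral_inner_laplacian_comm`), insert the equation, use
`∫ ⟪Δw, ΔΔw⟫ = ∫ ⟪ΔΔw, Δw⟫ = −‖∇Δw‖₂²` and drop `∫ ⟪∇q, ΔΔw⟫ = 0` (`ΔΔw` is divergence free,
`Torus.IsDivFree.laplacian_of_isSmooth` twice). Incompressibility of `u` is not needed.
[cite: FoiasManleyRosaTemam2001, App. II.A (A.55) and Ch. II §7] -/
theorem Torus.linearisedNS_hasDerivWithinAt_half_integral_norm_laplacian_sq
    {a b ν : ℝ} {u w : ℝ → UnitAddTorus d → EuclideanSpace ℝ d} {q : ℝ → UnitAddTorus d → ℝ}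
    (hu : Torus.IsSmoothSpaceTimeOn (Icc a b) u) (hw : Torus.IsSmoothSpaceTimeOn (Icc a b) w)
    (hq : Torus.IsSmoothSpaceTimeOn (Icc a b) q) (hwdiv : ∀ t ∈ Icc a b, Torus.IsDivFree (w t))
    (hlin : ∀ t ∈ Icc a b, ∀ x, Torus.timeDerivWithin (Icc a b) w t x +
      Torus.convect (u t) (w t) x + Torus.convect (w t) (u t) x =
        ν • Torus.laplacian (w t) x - Torus.gradient (q t) x)
    (hab : a < b) {t : ℝ} (ht : t ∈ Icc a b) :
    HasDerivWithinAt (fun s => 2⁻¹ * ∫ x, ‖Torus.laplacian (w s) x‖ ^ 2)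
      (-ν * Torus.gradNormSq (Torus.laplacian (w t)) -
        ∫ x, ⟪Torus.convect (u t) (w t) x + Torus.convect (w t) (u t) x,
          Torus.laplacian (Torus.laplacian (w t)) x⟫) (Icc a b) t := by
  set S : Set ℝ := Icc a b with hSdef
  have hSc : Convex ℝ S := convex_Icc a b
  have hU : UniqueDiffOn ℝ S := uniqueDiffOn_Icc hab
  have hwt : Torus.IsSmooth (w t) := hw.isSmooth_slice ht
  have hut : Torus.IsSmooth (u t) := hu.isSmooth_slice ht
  have hqt : Torus.IsSmooth (q t) := hq.isSmooth_slice ht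
  have hA : Torus.IsSmooth (Torus.timeDerivWithin S w t) := hw.isSmooth_timeDerivWithin hU ht
  have hWst : Torus.IsSmoothSpaceTimeOn S (fun s => Torus.laplacian (w s)) := hw.laplacian hU
  have hΔ : Torus.IsSmooth (Torus.laplacian (w t)) := hwt.laplacian
  have hΔΔ : Torus.IsSmooth (Torus.laplacian (Torus.laplacian (w t))) := hΔ.laplacian
  -- Step 1: differentiate `½ ∫ ‖Δw‖²` under the integral sign.
  have hφ : Torus.IsSmoothSpaceTimeOn S (fun s x => ‖Torus.laplacian (w s) x‖ ^ 2) := hWst.norm_sq ℝ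
  have hE : HasDerivWithinAt (fun s => 2⁻¹ * ∫ x, ‖Torus.laplacian (w s) x‖ ^ 2)
      (2⁻¹ * ∫ x, Torus.timeDerivWithin S
        (fun s x => ‖Torus.laplacian (w s) x‖ ^ 2) t x) S t :=
    (hφ.hasDerivWithinAt_integral hSc ht).const_mul 2⁻¹
  -- Step 2: `∂ₜ ‖Δw‖² = 2 ⟪Δ∂ₜw, Δw⟫`.
  have htd : ∀ x, Torus.timeDerivWithin S (fun s x => ‖Torus.laplacian (w s) x‖ ^ 2) t x =
      2 * ⟪Torus.laplacian (Torus.timeDerivWithin S w t) x, Torus.laplacian (w t) x⟫ := by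
    intro x
    have h1 := ((hWst.hasDerivWithinAt_slice ht x).norm_sq).derivWithin (hU t ht)
    rw [Torus.timeDerivWithin, h1, ← Torus.timeDerivWithin_laplacian_comm hab hw ht x, real_inner_comm]
  -- Step 3: Green, `∫ ⟪Δ∂ₜw, Δw⟫ = ∫ ⟪∂ₜw, ΔΔw⟫`.
  have hE' : 2⁻¹ * ∫ x, Torus.timeDerivWithin S
        (fun s x => ‖Torus.laplacian (w s) x‖ ^ 2) t x =
      ∫ x, ⟪Torus.timeDerivWithin S w t x, Torus.laplacian (Torus.laplacian (w t)) x⟫ := by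
    simp_rw [htd, integral_const_mul]
    rw [Torus.integral_inner_laplacian_comm hA hΔ]
    ring
  rw [hE'] at hE
  convert hE using 1
  -- Step 4: insert the equation; the pressure term drops out.
  have hA_eq : ∀ x, Torus.timeDerivWithin S w t x = ν • Torus.laplacian (w t) x -
      Torus.gradient (q t) x - (Torus.convect (u t) (w t) x + Torus.convect (w t) (u t) x) := by
    intro x
    rw [← hlin t ht x]
    abel
  have hF : Torus.IsSmooth (fun x => Torus.convect (u t) (w t) x + Torus.convect (w t) (u t) x) :=
    (hut.convect hwt).add (hwt.convect hut)
  have iL : Integrable (fun x => ⟪ν • Torus.laplacian (w t) x,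
      Torus.laplacian (Torus.laplacian (w t)) x⟫) volume := ((hΔ.smul ν).inner hΔΔ).integrable
  have iG : Integrable (fun x => ⟪Torus.gradient (q t) x, Torus.laplacian (Torus.laplacian (w t)) x⟫)
      volume := (hqt.gradient.inner hΔΔ).integrable
  have iF : Integrable (fun x => ⟪Torus.convect (u t) (w t) x + Torus.convect (w t) (u t) x,
      Torus.laplacian (Torus.laplacian (w t)) x⟫) volume := (hF.inner hΔΔ).integrable
  have hsplit : ∫ x, ⟪Torus.timeDerivWithin S w t x, Torus.laplacian (Torus.laplacian (w t)) x⟫ =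
      (∫ x, ⟪ν • Torus.laplacian (w t) x, Torus.laplacian (Torus.laplacian (w t)) x⟫) -
        (∫ x, ⟪Torus.gradient (q t) x, Torus.laplacian (Torus.laplacian (w t)) x⟫) -
        ∫ x, ⟪Torus.convect (u t) (w t) x + Torus.convect (w t) (u t) x,
          Torus.laplacian (Torus.laplacian (w t)) x⟫ := by
    simp_rw [hA_eq, inner_sub_left]
    rw [integral_sub ?_ iF, integral_sub iL iG]
    exact iL.sub iG
  -- the viscous term: `ν ∫ ⟪Δw, ΔΔw⟫ = ν ∫ ⟪ΔΔw, Δw⟫ = −ν ‖∇Δw‖₂²`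
  have hvisc : ∫ x, ⟪ν • Torus.laplacian (w t) x, Torus.laplacian (Torus.laplacian (w t)) x⟫ =
      -ν * Torus.gradNormSq (Torus.laplacian (w t)) := by
    have e1 : ∫ x, ⟪ν • Torus.laplacian (w t) x, Torus.laplacian (Torus.laplacian (w t)) x⟫ =
        ν * ∫ x, ⟪Torus.laplacian (Torus.laplacian (w t)) x, Torus.laplacian (w t) x⟫ := by
      rw [← integral_const_mul]
      refine integral_congr_ae (ae_of_all _ fun x => ?_)
      simp only [real_inner_smul_left, real_inner_comm]
    rw [e1, Torus.integral_inner_laplacian_self_eq_neg_gradNormSq hΔ]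
    ring
  have hpres : ∫ x, ⟪Torus.gradient (q t) x, Torus.laplacian (Torus.laplacian (w t)) x⟫ = 0 :=
    Torus.integral_inner_gradient_eq_zero_of_isDivFree hΔΔ hqt
      (Torus.IsDivFree.laplacian_of_isSmooth hΔ
        (Torus.IsDivFree.laplacian_of_isSmooth hwt (hwdiv t ht)))
  rw [hsplit, hvisc, hpres]
  ring

/-! ### The flux bound on `T³` -/

/-- **The `H²` flux of the linearised equation on `T³` is controlled by the `H²` energy** (`ν > 0`,
zero-mean `w`). On `T^d` with `card d = 3` there is `K > 0` such that for every `ν > 0`, all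
smooth `v, w : T^d → ℝ^d` with `∫ w = 0`, `‖v‖ ≤ M` and `‖∂ₖv‖ ≤ L` on `T^d`, and
`F = (v·∇)w + (w·∇)v`,
`−ν‖∇Δw‖₂² − ∫ ⟪F, ΔΔw⟫ ≤ ν⁻¹ (2dM² ‖Δw‖₂² + 4d²L² ‖∇w‖₂² + 2dK (‖∇w‖₂² + ‖Δw‖₂²) ‖Δv‖₂²)`:
Young `|∫ ⟪F, ΔΔw⟫| ≤ (2ν)⁻¹‖∇F‖₂² + (ν/2)‖∇Δw‖₂²` (`Torus.abs_integral_inner_laplacian_le_gradNormSq`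
with `ε = ν⁻¹`), `‖∇F‖₂² ≤ 2‖∇((v·∇)w)‖₂² + 2‖∇((w·∇)v)‖₂²`, the transport shape
`‖∇((v·∇)w)‖₂² ≤ 2dM²‖Δw‖₂² + 2d²L²‖∇w‖₂²` and the stretching shape
`‖∇((w·∇)v)‖₂² ≤ 2d‖w‖²_∞‖Δv‖₂² + 2d²L²‖∇w‖₂²` with the sup-norm embedding
`‖w‖²_∞ ≤ K(‖∇w‖₂² + ‖Δw‖₂²)` of zero-mean fields on `T³` — the linearised form of the `k = 2`
differential inequality (7.3) of Robinson–Rodrigo–Sadowski 2016 ("`B` maps `D(A) × D(A)` into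
`V`", Constantin–Foias 1988 Ch. 6). [folklore] -/
theorem Torus.linearisedNS_laplacian_flux_le (hd : Fintype.card d = 3) :
    ∃ K : ℝ, 0 < K ∧ ∀ {ν : ℝ}, 0 < ν → ∀ {v w : UnitAddTorus d → EuclideanSpace ℝ d},
      Torus.IsSmooth v → Torus.IsSmooth w → Torus.HasZeroMean w →
      ∀ {M L : ℝ}, (∀ x, ‖v x‖ ≤ M) → (∀ (k : d) (x : UnitAddTorus d), ‖Torus.partialDeriv k v x‖ ≤ L) →
        -ν * Torus.gradNormSq (Torus.laplacian w) -
            ∫ x, ⟪Torus.convect v w x + Torus.convect w v x, Torus.laplacian (Torus.laplacian w) x⟫ ≤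
          ν⁻¹ * (2 * Fintype.card d * M ^ 2 * (∫ x, ‖Torus.laplacian w x‖ ^ 2) +
            4 * Fintype.card d ^ 2 * L ^ 2 * Torus.gradNormSq w +
            2 * Fintype.card d * K * (Torus.gradNormSq w + ∫ x, ‖Torus.laplacian w x‖ ^ 2) *
              ∫ x, ‖Torus.laplacian v x‖ ^ 2) := by
  obtain ⟨K, hK, hsup⟩ := Torus.norm_sq_le_gradNormSq_add_of_hasZeroMean (d := d) hd
  refine ⟨K, hK, fun {ν} hν {v w} hv hw h0 {M L} hM hL => ?_⟩
  set G : ℝ := Torus.gradNormSq w with hG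
  set Y : ℝ := ∫ x, ‖Torus.laplacian w x‖ ^ 2 with hY
  set Yv : ℝ := ∫ x, ‖Torus.laplacian v x‖ ^ 2 with hYv
  set Z : ℝ := Torus.gradNormSq (Torus.laplacian w) with hZ
  have hG0 : 0 ≤ G := Torus.gradNormSq_nonneg _
  have hY0 : 0 ≤ Y := integral_nonneg fun x => sq_nonneg _
  have hYv0 : 0 ≤ Yv := integral_nonneg fun x => sq_nonneg _
  have hZ0 : 0 ≤ Z := Torus.gradNormSq_nonneg _
  have hd0 : (0 : ℝ) ≤ Fintype.card d := Nat.cast_nonneg _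
  have hF1 : Torus.IsSmooth (Torus.convect v w) := hv.convect hw
  have hF2 : Torus.IsSmooth (Torus.convect w v) := hw.convect hv
  have hF : Torus.IsSmooth (fun x => Torus.convect v w x + Torus.convect w v x) := hF1.add hF2
  have hΔ : Torus.IsSmooth (Torus.laplacian w) := hw.laplacian
  -- Young: `|∫ ⟪F, ΔΔw⟫| ≤ (ν⁻¹/2) ‖∇F‖₂² + (ν/2) ‖∇Δw‖₂²`
  have hε : 0 < ν⁻¹ := inv_pos.2 hν
  have h1 := Torus.abs_integral_inner_laplacian_le_gradNormSq hF hΔ hε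
  have hinv : (2 * ν⁻¹)⁻¹ = ν / 2 := by
    rw [mul_inv, inv_inv]; ring
  rw [hinv] at h1
  have h1' := (neg_le_abs _).trans h1
  -- the sup bound `‖w‖ ≤ M₀`, `M₀² = K (G + Y)`
  set M₀ : ℝ := Real.sqrt (K * (G + Y)) with hM₀
  have hM₀2 : M₀ ^ 2 = K * (G + Y) := Real.sq_sqrt (by positivity)
  have hM₀x : ∀ x, ‖w x‖ ≤ M₀ := fun x => by
    rw [hM₀, ← Real.sqrt_sq (norm_nonneg (w x))]
    exact Real.sqrt_le_sqrt (hsup w hw h0 x)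
  -- the two gradient bounds and `‖∇(F₁ + F₂)‖₂² ≤ 2‖∇F₁‖₂² + 2‖∇F₂‖₂²`
  have h2 := Torus.gradNormSq_convect_le_of_norm_left_le hv hw hM hL
  have h3 := Torus.gradNormSq_convect_le_of_norm_right_le hw hv hM₀x hL
  rw [hM₀2] at h3
  have h4 : Torus.gradNormSq (fun x => Torus.convect v w x + Torus.convect w v x) ≤
      2 * Torus.gradNormSq (Torus.convect v w) + 2 * Torus.gradNormSq (Torus.convect w v) :=
    Torus.gradNormSq_add_le hF1 hF2
  have hgF : Torus.gradNormSq (fun x => Torus.convect v w x + Torus.convect w v x) ≤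
      4 * Fintype.card d * M ^ 2 * Y + 8 * Fintype.card d ^ 2 * L ^ 2 * G +
        4 * Fintype.card d * (K * (G + Y)) * Yv := by
    linarith [h4, h2, h3]
  have hνZ : 0 ≤ ν / 2 * Z := by positivity
  have hkey : -ν * Z -
      ∫ x, ⟪Torus.convect v w x + Torus.convect w v x, Torus.laplacian (Torus.laplacian w) x⟫ ≤
      ν⁻¹ / 2 * Torus.gradNormSq (fun x => Torus.convect v w x + Torus.convect w v x) := by
    have hνZ' : 0 ≤ ν * Z := by positivity
    linarith [h1', hνZ, hνZ']
  calc -ν * Z -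
        ∫ x, ⟪Torus.convect v w x + Torus.convect w v x, Torus.laplacian (Torus.laplacian w) x⟫
      ≤ ν⁻¹ / 2 * Torus.gradNormSq (fun x => Torus.convect v w x + Torus.convect w v x) := hkey
    _ ≤ ν⁻¹ / 2 * (4 * Fintype.card d * M ^ 2 * Y + 8 * Fintype.card d ^ 2 * L ^ 2 * G +
        4 * Fintype.card d * (K * (G + Y)) * Yv) := mul_le_mul_of_nonneg_left hgF (by positivity)
    _ = ν⁻¹ * (2 * Fintype.card d * M ^ 2 * Y + 4 * Fintype.card d ^ 2 * L ^ 2 * G +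
        2 * Fintype.card d * K * (G + Y) * Yv) := by ring

end Literature.Analysis.FluidPDE

end
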